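import Literature.Probability.FitznerVanDerHofstad2017.NobleInstantiate
import HarnessLib

/-!
# `d = 11`: mean-field behaviour of nearest-neighbour percolation on `ℤ¹¹` from a certified NoBLE bootstrap

CITATION HEADER (PLACEMENT v2). This module is part of a certified REPRODUCTION of:
R. Fitzner, R. van der Hofstad, *Mean-field behavior for nearest-neighbor percolation in d > 10*,
Electron. J. Probab. 22 (2017), no. 43, 1–65 [FvdH17], and *Generalized approach to the non-backtracking
lace expansion*, Probab. Theory Related Fields 169 (2017), 1041–1119 [NoBLE17] (arXiv:1506.07977, 1506.07969).
Reproduces: the per-dimension form of [NoBLE17] Def. 2.9 / Prop. 2.11 / Thm. 2.10 and its assembly with the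
hub tree's NoBLE→infrared→triangle→θ(p_c)=0 chain. Origin: build `lace`, staging package `LaceExpansionHighD`.

This file instantiates `LaceExpansionHighD.meanField_of_certificate`
at `d = 11` with the bootstrap constants of Fitzner–van der Hofstad:

* `Γ = (1.01306, 1.07513, 1)` — `Percolation.nb`, input cell "The parameter choice that works in
  d=11" (`Gamma1=1.01306; Gamma2=1.07513; Gamma3=1;`); [FvdH17] §2.5 prints `Γ₁ = 1.01306` and — a
  divergence recorded in `DIVERGENCE.md` D10 / REFEREE F1 — "`Γ₂ = 1.076`", while its Figure
  (notebook output, `d = 11`) shows the assumed bounds `1.01306, 1.07513, 1`. We use the NOTEBOOK value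
  `1.07513`, which is also the one behind Thm. 1.2's `A₂(11) ≤ 1.02393 = 1.07513 · 20/21`.
* `c = (c_{0,0,𝒳}, c_{1,0,𝒳}, c_{1,1,𝒳}, c_{1,2,𝒳}, c_{1,3,𝒳}, c_{1,6,{0}}) = (0.0661, 0.108, 0.05352, 0.0404, 0.022, 0.008714)`
  in the order of the tree's `nobleTriple` — `Percolation.nb` same cell (`c[0,0,1]=0.0661; c[1,0,1]=0.108;
  c[1,1,1]=0.05352; c[1,2,1]=0.0404; c[1,3,1]=0.022; c[1,6,0]=0.008714`); [FvdH17] Figure 3 ("Assumed").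
* `c_μ = 1.0029684` — `Percolation.nb` same cell (`cmu=1.0029684;`); NOT printed in [FvdH17]
  (`CONSTANTS.md`).
* `γ = (1.0130591, 1.0751235, 0.99998)` — a REFERENCE choice of the target constants (any `γ_i` with
  concluded bound `≤ γ_i < Γ_i` will do; [FvdH17] Figure 3 prints the concluded bounds
  `1.01305907, 1.07512348, 0.999971`; §2.5 prints `(2d-1) p_c(11) ≤ γ₁ = 1.0130591`).

LOAD-BEARING vs FREE constants. Only `Γ` (the a-priori region, behind Thm. 1.1's `(2d-1)p_c ≤ Γ₁` and
Thm. 1.2's `A₂ = Γ₂·(2d-2)/(2d-1)`) and `c_μ` are fixed in the statements below; the target constants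
`γ` and the `f₃`-weights `c = (c_{n,l,S})` are FREE PARAMETERS OF THE PROOF ([FvdH17] §2.5: chosen by a
fixed-point iteration) and are therefore ARGUMENTS of `meanField_d11`, supplied by the certificate file
together with the tables (`DIVERGENCE.md` D12/D16, num1 2026-08-18: with two notebook slips corrected the
published weights miss by ≤ 8.1e-7 in three `f₃` cells while re-chosen weights `c'` (relative change
≤ 2.2e-5) close the bootstrap with the SAME `Γ`, `c_μ`). `D11.gamma` / `D11.cWeights` below record the
published reference values and are not used by the theorems.

The `β`-tables `Bi` (initialisation at `p_I = 1/21`) and `Bo` (improvement step) and the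
weighted-diagram bound vectors `bi`, `bo` are the CERTIFIED outputs of the two interval engines
(`HOME/AGREE.md`). `meanField_d11` below carries the numeric certificate at the PUBLISHED `Γ`, `c_μ` as the named
hypothesis `hN : NobleNumericCertificate 11 cMu c γ Gamma Bi Bo bi bo` — a hypothesis that NO certified computation
discharges under the print-faithful protocol (next paragraph: the published tuple fails); the DISCHARGED certificate is
`D11.nobleCertificate_d11 : NobleNumericCertificate 11 D11.cMuC D11.cWeightsC D11.gammaC D11.GammaC Bi Bo bi bo`
(`MeanFieldD11Cert.lean`, 36 inequalities by `norm_num`, at RE-TUNED `D11.GammaC`, `D11.cMuC` — THAT MODULE'S DOCSTRING IS THE SINGLE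
SOURCE OF TRUTH for the tuple, the cited class, the certificate files and their sha256; its revisions 1–2a carry the tuple U12r
`Γ = (1.01148, 1.06758, 1)`, `c_μ = 1.002906` described below, revisions 3–5 the KSUP tuple K12 of HOME/DIVERGENCE.md D39, revision 6 the
tuple O12g on the print-faithful cell of record `wborbx + wbg2 + hexprint` — see the two STATUS paragraphs below),
instantiated through `meanField_of_certificate` (`NobleInstantiate.lean`, `Γ`, `c_μ` arguments) as `D11.meanField_d11_cert (hI) (hS)`,
with the input-level twin `D11.nobleCertificate_d11_inputs` / `D11.meanField_d11_inputs` (`MeanFieldD11Inputs.lean`: the kernel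
evaluates the typed [NoBLE17, App. D] map `BetaMap.nobleBetaOfInputs` on 60 certified input bounds per stage). RELATION OF THE
CERTIFIED TUPLE TO THE PUBLISHED `Gamma` (REFEREE v33 F-D46 RULING (3)(c), v36 ORDERS (3)): for the tuples U12r (`1.01148 < 1.01306`,
`1.06758 < 1.07513`) and K12 (`1.01197532 < 1.01306`, `1.07186139 < 1.07513`) of revisions 1–5, `D11.GammaC < Gamma` held component-wise in the
two load-bearing entries, so the published a-priori statements ((2d−1)p_c ≤ Γ₁, A₂ = Γ₂(2d−2)/(2d−1)) followed a fortiori from the certified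
ones; for the tuple O12g of revision 6 (`D11.GammaC = (1.0121756, 1.1084502, 1)`, forced by the printed orbit multiplicities restored on the
cell of record, HOME/DIVERGENCE.md D46) this holds for the FIRST entry only: `1.0121756 < 1.01306`, so `(2d−1)p_c(ℤ¹¹) ≤ γ₁ = 1.0119705 <
1.0130591` still sharpens [FvdH17] §2.5, but `Γ₂ = 1.1084502 > 1.07513` — the certified infrared constant is `τ̂_p(k)[1 − D̂(k)] ≤ (20/21)·γ₂`
with `γ₂ = 1.108259`, i.e. `A₂(11) ≤ 1.05549`, NOT the printed `A₂(11) ≤ 1.02393` of [FvdH17] Thm. 1.2 (which no print-faithful two-engine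
run of this packet certifies; every corrected least fixed point has Γ₂* ≥ 1.105, HOME/NUMERICS.md §B20.9). The 'a fortiori' sentence of the
earlier revisions of this docstring is therefore RETIRED for the second entry. The theorems of THIS module are stated at the published `Gamma`
with the numeric certificate as the HYPOTHESIS `hN` and are unaffected (no certified computation discharges `hN` at `Gamma`; the
discharged statements are `D11.meanField_d11_cert` / `D11.nobleBootstrapBound_d11_cert` at `D11.GammaC`). The
reference values are sanity-checked below (`gamma_lt_Gamma`, `cWeights_pos`, `one_lt_cMu`, and — against
the rounded figures of [FvdH17] Figure 3, as a digit-for-digit comparison target, NOT as the certificate —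
`f3_target_fig`).

STATUS SINCE REFEREE v32–v36 (HOME/DIVERGENCE.md D46 `wborbx`, D34 `wbg2`, D49 `hexprint`, 2026-08-19): three further notebook-vs-print
repairs define the print-faithful CELL OF RECORD `wborbx + wbg2 + hexprint` (the printed orbit multiplicities |O_d(v)| and own-type G-sums of
[NoBLE17-I] §5.3.3 in the weighted-bubble pieces i = 3, 4, 5 — thesis [Fit13] p. 237 (5.1.45)/(5.1.48)/(5.1.49) prints them; the printed Γ̄₂ on
the weighted-bubble K-tails, [NoBLE17] §5.3.2; the printed hexagon exponent 16(d−1)(d−2)(2d−3)−1 of [FvdH17-II] Lemma 5.3, `BoundNOne.tex`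
l.92). On that cell the K12 tuple of revisions 3–5 does not close (a tuple change, REFEREE v34 R-D46c (v)) and the bootstrap closes again at
the re-tuned padded tuple O12g `Γ = (1.0121756, 1.1084502, 1)`, `c_μ = 1.0028981`, `c = (0.1327003, 0.1998869, 0.0809251, 0.0639586,
0.0335958, 0.01277324)`, 30/30 in all four classes U/S × (12,28)/(13,28) on two engines / three implementations (engine A native num1-g9
kit j048028, engine A via num2's wrapper kit j047962, engine B `chain.py` g8; REFEREE v36 R-D46d: 2096/2096 cells overlap, ref2-R20
discharged) — U (12,28) margins(o) Γ − f(o) = (2.05e−4, 1.91e−4, 1.12e−4). `MeanFieldD11Cert.lean` REVISION 6 carries that tuple (its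
docstring = the record); the paragraphs below are the record as of R41 / R30 and are kept as history.

STATUS SINCE REFEREE v10 R41 (HOME/DIVERGENCE.md D39 "KSUP", 2026-08-18): a fourth notebook-vs-print slip sits INSIDE the runs
described in the next paragraph — Percolation.nb uses the e₁-special SRW.nb cell `K[n,l,{1}] = Min[√(I_{n,2l}(0) L_n(e₁)), |I_{n,l+1}(0)|]`
as `sup_{x≠0} K_{n,l}(x)` "by Lemma 5.1 of (I)", while [NoBLE17] Lemma 5.1 (monotonicity of I_{n,l}(x), L_n(x) only) justifies only
`sup_{x≠0} K ≤ max(K_valid(e₁), K(2e₁), K(e₁+e₂))` (rule KSUP; kernel `srwK_le_sqrt_srwI_mul_srwL`, `SrwIntegralBounds.lean`). Hence the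
tuple U12r below is, since R41, a FIDELITY certificate of the notebook-wired K cells (revisions 1–2a of `MeanFieldD11Cert.lean`,
p177007 / p177395 / p177486; permanent home `MeanFieldD11CertU12r.lean`, namespace `D11.U12r`), NOT the cited tuple: under KSUP it fails at
(12,28) in float (Γ − f(o) = −2.1e-4 / −1.9e-3 / −3.8e-2, seat tail-g2) and the bootstrap closes again at a re-tuned padded tuple
(engine A float: Γ ≈ (1.0119, 1.0716, 1), c_μ ≈ 1.00289), which revision 3 of `MeanFieldD11Cert.lean` is to certify with two engines
(REFEREE v10 C17; pending when this paragraph was written). Every theorem of THIS module is generic in the constants and unaffected; the paragraph below is the record as of R30.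

WHICH COMPUTATION CERTIFIES WHICH CONSTANTS (REFEREE v7 C3⁗/C6′, R25–R28, v8 R30; SUSPENDED by v10 R41 as far as "cited" goes — see STATUS
above; HOME/AGREE.md §2d + ADDENDUM, HOME/CONSTANTS.md §I, HOME/DIVERGENCE.md). THE R30 CERTIFICATE (`MeanFieldD11Cert.lean` revisions 1–2a)
= the PRINT-FAITHFUL protocol of [NoBLE17]/[FvdH17] with every
non-conservative slip of the published notebooks recorded UP TO R30 repaired FROM PRINT (the K-sup slip of D39 is not) — valid
SRW-integral table `K` (referee F8/R12.5: the
published notebook's `K[n,l,{1}]`, even `l`, is not an upper bound), D12 (open-polygon product), D16′, D21(α) (R14), D26, D27(c), the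
D27 print-only remainder multiplicities (R13; BOTH readings of the printed closed counts, R13/R28), and D31 = the WEIGHTED
`β^{(0)}_{ΔΞ,R}+β^{(1)}_{ΔΞ,R}` in the (D.21) slot as PRINTED ([NoBLE17] p. 1115; R25 — `Percolation.nb` passes the unweighted pair) —
at enumeration orders `(ComputedSteps, MaxNumberOfSteps) = (12, 28)`, tuple "U12r" `Γ = (1.01148, 1.06758, 1)`, `c_μ = 1.002906`,
`c = (0.069054, 0.110239, 0.055689, 0.042469, 0.022139, 0.008691)`, TWO ENGINES (A: python-flint/Arb 160-bit, kit j038821; B: 150-bit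
`mpmath.iv` interpreter of the notebook cells) × BOTH closed-count readings, 614/614 cells overlapping in each pairing; certificate
files (sha256, 16 hex) `cert_d11_printonlyU_d31_CS12_MS28_U12r.json` 3012db6f9a96d54d, `cert_d11_B4_printonlyU-d31_CS12_MS28_U12r.json`
f621153956449394, `cert_d11_printonly_d31_CS12_MS28_U12r.json` 83a362d6e4c46c34, `cert_d11_B4_printonly-d31_CS12_MS28_U12r.json`
816b5a8e1b609765 (Lean literals = cell-wise weakest of the four). NEGATIVE RECORD (certified, two engines): under this protocol the
PUBLISHED tuple (`Gamma`, `cMu`, Fig. 3 `c`) does NOT close — at (12,28) `f₃(o)` exceeds `γ₃ = 1` by 4.82e-2 (sharp closed counts) /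
5.12e-2 (dominating counts), and at the published orders (10,20) all of `f₁, f₂, f₃` fail; at (10,20) the protocol closes only with a
DEGRADED `Γ₁ ≥ 1.01329` (least fixed point; e.g. the padded tuple `Γ = (1.0136607, 1.0843064, 1)`, sharp reading — recorded, not
landed). Earlier closures that evaluate the NOTEBOOK-wired (D.21) (AGREE §2/§2b/§2c: the authors' computation reproduced digit for
digit at (10,20); the paper-faithful variant with re-tuned `Γ = (1.0132763, 1.07821, 1)`, `c_μ = 1.002971`) are "reproduction /
comparison variants" (R25(c)) and certify nothing citable. `meanField_d11` below is the published-constants specialisation, kept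
as the digit-for-digit comparison frame; the theorem that a certified computation discharges is `D11.meanField_d11_cert`.

References: [FvdH17] R. Fitzner, R. van der Hofstad, Mean-field behavior for nearest-neighbor
percolation in d > 10, Electron. J. Probab. 22 (2017) no. 43, arXiv:1506.07977 — Thm. 1.1, Thm. 1.2,
Cor. 1.3, §2.5 and Figure 3; [NoBLE17] same authors, Generalized approach to the non-backtracking lace
expansion, Probab. Theory Relat. Fields 169 (2017), arXiv:1506.07969 — Def. 2.9, Thm. 2.10, Prop. 2.11;
`Percolation.nb` from www.fitzner.nl/noble/ (staged: HOME/inputs/files/anc/fitzner-noble-site/).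
-/

noncomputable section

namespace Literature.Probability.FitznerVanDerHofstad2017

open Literature.Barriers.CriticalPhenomena Literature.Probability.Percolation
open Literature.Probability.LatticeModels

namespace D11

/-- `Γ(11) = (Γ₁, Γ₂, Γ₃) = (1.01306, 1.07513, 1)` — PUBLISHED REFERENCE VALUE ([FvdH17] Fig. 3,
"Assumed"). [cite: FitznerVanDerHofstad2017, §2.5 and Figure 3 ("Assumed bound Γ_i")] -/
def Gamma : Fin 3 → ℝ := ![1.01306, 1.07513, 1]

/-- PUBLISHED REFERENCE VALUES ([FvdH17] Fig. 3 / §2.5): target constants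
`γ(11) = (1.0130591, 1.0751235, 0.99998)` (see the module docstring;
the theorems take `γ` from the certificate).
[cite: FitznerVanDerHofstad2017, §2.5 ((2d-1)p_c(11) ≤ 1.0130591) and Figure 3 (concluded bounds)] -/
def gamma : Fin 3 → ℝ := ![1.0130591, 1.0751235, 0.99998]

/-- PUBLISHED REFERENCE VALUES ([FvdH17] Fig. 3): the `f₃` weights `c_{n,l,S}` at `d = 11` (the theorems take `c` from the
certificate), indexed like `nobleTriple`:
`(c_{0,0,𝒳}, c_{1,0,𝒳}, c_{1,1,𝒳}, c_{1,2,𝒳}, c_{1,3,𝒳}, c_{1,6,{0}}) = (0.0661, 0.108, 0.05352, 0.0404, 0.022, 0.008714)`.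
[cite: FitznerVanDerHofstad2017, Figure 3 ("Assumed" row) and Percolation.nb (input cell "parameter choice that works in d=11")] -/
def cWeights : Fin 6 → ℝ := ![0.0661, 0.108, 0.05352, 0.0404, 0.022, 0.008714]

/-- PUBLISHED REFERENCE VALUE (the authors' published notebook Percolation.nb, `cmu=1.0029684;` — not
printed in the paper, not in Fig. 3): `c_μ = 1.0029684` at `d = 11`.
[cite: FitznerVanDerHofstad2017, §2.5 (the notebook Percolation, available from the Fitzner NoBLE page)] -/
def cMu : ℝ := 1.0029684

/-- `γ_i < Γ_i`, `i = 1, 2, 3` (margins `9·10⁻⁷`, `6.5·10⁻⁶`, `2·10⁻⁵`); decimal arithmetic. [folklore] -/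
theorem gamma_lt_Gamma : ∀ i, gamma i < Gamma i := by
  intro i
  fin_cases i <;> simp [gamma, Gamma] <;> norm_num

/-- `c_{n,l,S} > 0`; decimal arithmetic. [folklore] -/
theorem cWeights_pos : ∀ k, 0 < cWeights k := by
  intro k
  fin_cases k <;> simp [cWeights] <;> norm_num

/-- `c_μ > 1`; decimal arithmetic. [folklore] -/
theorem one_lt_cMu : 1 < cMu := by
  norm_num [cMu]

/-- PUBLISHED REFERENCE VALUES ([FvdH17] Fig. 3, "concluded"): the weighted-diagram bounds at `d = 11` AS PRINTED (rounded),
in `nobleTriple` order: `(0.0660248, 0.107997, 0.0535177, 0.040359, 0.0219457, 0.00871352)`.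
Comparison target for the engines (REFEREE gate item), NOT the certificate.
[cite: FitznerVanDerHofstad2017, Figure 3 (column "concluded", d = 11)] -/
def boFig : Fin 6 → ℝ := ![0.0660248, 0.107997, 0.0535177, 0.040359, 0.0219457, 0.00871352]

/-- With the printed figures, `max_k b_k / c_k = 0.107997/0.108 = 0.99997… ≤ γ₃ = 0.99998 < Γ₃ = 1`
(the figure's "0.999971"). Digit-for-digit target only. [folklore] -/
theorem f3_target_fig : ∀ k, boFig k / cWeights k ≤ gamma 2 := by
  intro k
  fin_cases k <;> simp [boFig, cWeights, gamma] <;> norm_num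

/-- **Mean-field behaviour for nearest-neighbour bond percolation on `ℤ¹¹`** — the triangle
condition `T(p_c) < ∞`, continuity `θ(p_c) = 0`, and `β = 1` (bounded-ratio sense) — from:
`hI`, the initialisation inputs at `p_I = 1/21` with `β`-table `Bi` and diagram bounds `bi`
([NoBLE17] §3.3.3); `hS`, the improvement inputs on `(1/21, p_c)` for `Γ = (1.01306, 1.07513, 1)`,
`c_μ = 1.0029684` and `f₃`-weights `c`, with `β`-table `Bo` and diagram bounds `bo` ([FvdH17] Props. 2.1,
2.2; [NoBLE17] Ass. 2.7, Lemma 3.1, §4, App. D, (3.80)); and `hN`, the NUMERIC CERTIFICATE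
([NoBLE17] Def. 2.9 / Prop. 2.11 conditions on the constants, for target constants `γ < Γ`) —
discharged by `norm_num` from the two-engine certified tables (`nobleCertificate_d11`, file
`MeanFieldD11Cert.lean`, certificate sha256 quoted there) once `AGREE.md` has them. The free proof
parameters `γ`, `c` are arguments (fixed by the certificate; reference values `D11.gamma`, `D11.cWeights`). Continuity of `f₁, f₂, f₃` ([NoBLE17] Lemmas 3.3, 3.5)
and everything downstream of the NoBLE bound are THEOREMS (hub tree, vendored).
STATUS OF THE RESULT (REFEREE V1(b), GAPS.md G8): `hI` and `hS`, once their tables are numerals, are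
NOT CITABLE hypotheses — the programme's two-engine EVALUATION of the published `β`-formulas, neither
published theorems nor kernel-proved — so this theorem is "the `d = 11` numerical verification of
Fitzner–van der Hofstad re-run with certified arithmetic, assembled by the kernel", CONDITIONAL on that
evaluation; it is NOT "the `d = 11` theorem re-verified" until the map `Γ ↦ β` is typed (V1(a)).
`#print axioms`: `propext, Classical.choice, Quot.sound`.
[cite: FitznerVanDerHofstad2017, Thm. 1.1, Thm. 1.2 (d = 11 row), Cor. 1.3, Prop. 2.4, §2.5]
[cite: FitznerVanDerHofstad2016NoBLE, Def. 2.9, Thm. 2.10, Prop. 2.11, Lemma 3.5] -/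
theorem meanField_d11 {γ : Fin 3 → ℝ} {c : Fin 6 → ℝ} {Bi Bo : NobleBeta} {bi bo : Fin 6 → ℝ}
    (hN : NobleNumericCertificate 11 cMu c γ Gamma Bi Bo bi bo)
    (hI : NobleInitialInputsAt 11 Bi bi)
    (hS : NobleImprovementInputsAt 11 cMu c Gamma Bo bo) :
    TriangleCondition 11 ∧ PercolationContinuity 11 ∧ BetaEqOneBoundedRatio 11 :=
  meanField_of_certificate (by norm_num) hN hI hS

/-- `θ(p_c(ℤ¹¹)) = 0` alone, from the same hypotheses. [cite: FitznerVanDerHofstad2017, Cor. 1.3] -/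
theorem percolationContinuity_d11 {γ : Fin 3 → ℝ} {c : Fin 6 → ℝ} {Bi Bo : NobleBeta} {bi bo : Fin 6 → ℝ}
    (hN : NobleNumericCertificate 11 cMu c γ Gamma Bi Bo bi bo)
    (hI : NobleInitialInputsAt 11 Bi bi)
    (hS : NobleImprovementInputsAt 11 cMu c Gamma Bo bo) : PercolationContinuity 11 :=
  (meanField_d11 hN hI hS).2.1

/-- `γ = 1` on `ℤ¹¹` (`χ(p) ≍ (p_c - p)⁻¹`), from the same hypotheses. [cite: FitznerVanDerHofstad2017, Cor. 1.3] -/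
theorem gamma_eq_one_d11 {γ : Fin 3 → ℝ} {c : Fin 6 → ℝ} {Bi Bo : NobleBeta} {bi bo : Fin 6 → ℝ}
    (hN : NobleNumericCertificate 11 cMu c γ Gamma Bi Bo bi bo)
    (hI : NobleInitialInputsAt 11 Bi bi)
    (hS : NobleImprovementInputsAt 11 cMu c Gamma Bo bo) :
    ∃ A B δ : ℝ, 0 < A ∧ 0 < B ∧ 0 < δ ∧
      ∀ p : unitInterval, criticalProb (zdGraph 11) (0 : Site 11) - δ < p →
        (p : ℝ) < criticalProb (zdGraph 11) 0 →
          ENNReal.ofReal (A / (criticalProb (zdGraph 11) 0 - p)) ≤ expClusterSize (zdGraph 11) 0 p ∧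
            expClusterSize (zdGraph 11) 0 p ≤ ENNReal.ofReal (B / (criticalProb (zdGraph 11) 0 - p)) :=
  gamma_eq_one_of_certificate (by norm_num) hN hI hS

/-- The NoBLE infrared bound at `d = 11` in the printed form of [FvdH17] Thm. 1.2:
`τ̂_p(k)[1 - D̂(k)] ≤ (20/21) γ₂` on `[1/21, p_c)` for the certificate's `γ₂ < Γ₂ = 1.07513`, i.e.
`A₂(11) < 1.02393…` (conditional; see header: the record certifies (20/21)·γ₂ = 1.05549, not 1.02393)
(the table's `A₂(11) ≤ 1.02393 = 1.07513 · 20/21`; with the reference `γ₂ = 1.0751235`, `A₂(11) ≤ 1.0239271…`).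
[cite: FitznerVanDerHofstad2017, Thm. 1.2 (row d = 11: A₂(11) ≤ 1.02393)] -/
theorem nobleBootstrapBound_d11 {γ : Fin 3 → ℝ} {c : Fin 6 → ℝ} {Bi Bo : NobleBeta} {bi bo : Fin 6 → ℝ}
    (hN : NobleNumericCertificate 11 cMu c γ Gamma Bi Bo bi bo)
    (hI : NobleInitialInputsAt 11 Bi bi)
    (hS : NobleImprovementInputsAt 11 cMu c Gamma Bo bo) : NobleBootstrapBound 11 :=
  nobleBootstrapBound_of_certificate (by norm_num) hN hI hS

end D11

/-! ### The `d = 10` slot (rung 1 of the ladder; no certificate is known — [FvdH17] §2.7) -/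

/-- **Rung `d = 10` (slot)**: the same theorem at `d = 10`, for ANY constants carrying a numeric
certificate. [FvdH17] §2.7 reports that with their bounds the `f₃`-improvement fails at `d = 10`;
the census (`HOME/GAPS.md`, numerics seats) localises the first failing inequality. A proof of
`NobleNumericCertificate 10 …` for some analytic-input tables would make this rung a theorem.
[cite: FitznerVanDerHofstad2017, §2.7 (d = 10: "the improvement of f₃(p) becomes problematic")] -/
theorem meanField_d10 {cμ : ℝ} {c : Fin 6 → ℝ} {γ Γ : Fin 3 → ℝ} {Bi Bo : NobleBeta}
    {bi bo : Fin 6 → ℝ}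
    (hN : NobleNumericCertificate 10 cμ c γ Γ Bi Bo bi bo) (hI : NobleInitialInputsAt 10 Bi bi)
    (hS : NobleImprovementInputsAt 10 cμ c Γ Bo bo) :
    Literature.Probability.Percolation.TriangleCondition 10 ∧
      Literature.Probability.Percolation.PercolationContinuity 10 ∧
        Literature.Probability.Percolation.BetaEqOneBoundedRatio 10 :=
  meanField_of_certificate (by norm_num) hN hI hS

end Literature.Probability.FitznerVanDerHofstad2017

end
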